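import Summits.CriticalPhenomena.Ising3DConformalLimit.Theses.PerfectScreening
import Summits.CriticalPhenomena.Ising3DConformalLimit.Theorems.PerfectScreeningGaussianLimitNotScreenedFatSpreadCluster
import Summits.CriticalPhenomena.Ising3DConformalLimit.Theorems.CoulombImpliesNontrivial.Negative.Antecedent
import HarnessLib

/-!
# Crux `CoulombImpliesNontrivial` (stmt-CriticalPhenomena-13885), line `merging-is-expected-screening`:
# the crux REDUCES to the Ising capacity of spread free defects (crux 13886's open heart), kernel-checked

Route PerfectScreening (r3). Crux decl `Summit.CriticalPhenomena.Ising3DConformalLimit.Theses.PerfectScreening.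
CoulombImpliesNontrivial`: `(∃ c > 0, ∀ x ≠ 0, c/‖x‖ ≤ criticalTwoPoint 3 x) → ∀ ρ S, (ρ > 0 on (0,1]) →
HasPointwiseScalingLimit (criticalCorr 3) ρ S → IsNondegenerateTwoPoint S → HasNontrivialU4 S`.

The line's idea (card `Cruxes/CoulombImpliesNontrivial/Ideas/merging-is-expected-screening.md`; planner's skeleton v1
with stubs S1 merge-from-screening, S2 certified double cluster, S3 capacity screening) coincides mechanism for
mechanism with the sister crux stmt-CriticalPhenomena-13886's line `karamata-amplitude-blind-merging`, whose provable
pieces are LANDED (`Theorems/PerfectScreeningGaussianLimitNotScreened{Defs,DepletionBound,ClusterMomentsBox,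
DyadicShellSums,OneArmAsymptotics*,FatSpreadCluster}.lean`). This file records, sorry-free:

* `twoCurrentMeet_lower_of_capacityAt` — the landed engine `twoCurrentMeet_lower_of_capacity` re-run with the
  capacity hypothesis supplied at ONE exponent `s < 3 − 2Δ` and only for AXIAL pairs, at any non-coincident
  quadruple whose screened pair is axial (used at `(0, e₀, 2e₀, 3e₀)`): fat spread cluster (`stub_fatSpreadCluster`) × capacity × Griffiths
  (`defectG_anti`) × ADC21 Lemma A.1 as an equality (`stub_depletionBound`) ⟹ `P² ≥ c'c`;
* `stub_cruxOfIsingCapacityAxial` (registered bookkeeping stub of crux 13885, the line's conditional assembly):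
  `(∃ s ∈ (0,2), axial Ising capacity at s) → CoulombImpliesNontrivial` BY NAME — the Coulomb antecedent enters only
  through `CoulombImpliesNontrivialNegative.canonical_of_coulomb` (`Δ = 1/2`, hence every `s < 2` is admissible),
  and Aizenman's criterion `hasNontrivialU4_of_twoCurrentMeet_lower` (crux 0636) concludes;
* `coulombImpliesNontrivial_of_isingCapacity`: crux 13886's registered `stub_isingCapacity` verbatim
  (`∀ s > 3/2`, all pairs) ⟹ crux 13885 (through `isingCapacityAxial_of_isingCapacity`, `s = 7/4`).

So crux 13885 is CLOSED MODULO one deterministic statement about the critical nearest-neighbour Ising₃ model — the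
depletion of `⟨σ_cσ_e⟩_{Λ_L}` by spread `s`-dimensional free defects for a single `s < 2` — which is a weakening of the
open registered stub of crux 13886. Conditional theorems: they credit nothing by themselves. No named fact is
introduced and no definition is made (pure proofs).

References: M. Aizenman, Comm. Math. Phys. 86 (1982) §1 [Aizenman1982]; M. Aizenman, H. Duminil-Copin, Ann. of
Math. 194 (2021) = arXiv:1912.07973, (3.11), §4.2 Lemma 4.4, App. A Lemma A.1 / Remark A.5 / Prop. A.3
[AizenmanDuminilCopinAnnals2021].
-/

noncomputable section

namespace Summit.CriticalPhenomena.Ising3DConformalLimit.Cruxes.CoulombImpliesNontrivial.MergingIsExpectedScreening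

open Filter Topology Set MeasureTheory Finset
open Literature.Probability.LatticeModels Literature.Probability.Percolation
open Summit.CriticalPhenomena.Ising3DConformalLimit.Cruxes.IsingEuclidUpgradeR4NonGaussian.FreeCovarianceDeltaDichotomy
  (lat boxG twoCurrentMeet ScaleCovariantOn eventually_lat_mem_box hasNontrivialU4_of_twoCurrentMeet_lower)
open Summit.CriticalPhenomena.Ising3DConformalLimit.Cruxes.GaussianLimitNotScreened.KaramataAmplitudeBlindMerging
  (IsSpreadDefect defectG traceCluster stub_fatSpreadCluster stub_depletionBound defectG_anti
    tendsto_norm_latticeApprox_sub_atTop)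
open Summit.CriticalPhenomena.Ising3DConformalLimit.CoulombImpliesNontrivialNegative (canonical_of_coulomb)
open scoped symmDiff

/-! ## The reduction (everything proved; no `sorry`, no new definition of substance) -/

/-- 13886's registered `stub_isingCapacity` (all `s > 3/2`, all pairs) implies this line's stub (take `s = 7/4`).
[folklore] -/
theorem isingCapacityAxial_of_isingCapacity
    (hcap : ∀ s : ℝ, 3 / 2 < s → ∀ K lam nu : ℝ, 0 < K → 0 < lam → 0 < nu →
      ∃ c' : ℝ, 0 < c' ∧ c' ≤ 1 ∧ ∃ R₀ : ℝ, ∀ c e : Site 3, R₀ ≤ ‖c - e‖ →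
        ∀ᶠ L : ℕ in atTop, ∀ C : Finset (Site 3), c ∉ C → e ∉ C →
          IsSpreadDefect s K lam nu c e C → defectG L C c e ≤ (1 - c') * boxG L c e) :
    ∃ s : ℝ, 0 < s ∧ s < 2 ∧ ∀ K lam nu : ℝ, 0 < K → 0 < lam → 0 < nu →
      ∃ c' : ℝ, 0 < c' ∧ c' ≤ 1 ∧ ∃ R₀ : ℝ, ∀ c e : Site 3, (∀ j : Fin 3, j ≠ 0 → e j = c j) →
        R₀ ≤ ‖c - e‖ → ∀ᶠ L : ℕ in atTop, ∀ C : Finset (Site 3), c ∉ C → e ∉ C →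
          IsSpreadDefect s K lam nu c e C → defectG L C c e ≤ (1 - c') * boxG L c e := by
  refine ⟨7 / 4, by norm_num, by norm_num, fun K lam nu hK hlam hnu => ?_⟩
  obtain ⟨c', hc', hc'1, R₀, h⟩ := hcap (7 / 4) (by norm_num) K lam nu hK hlam hnu
  exact ⟨c', hc', hc'1, R₀, fun c e _ hR => h c e hR⟩

/-- **ENGINE AT ONE EXPONENT** (the landed `twoCurrentMeet_lower_of_capacity` of crux 13886, re-run with the
capacity supplied at a SINGLE exponent `s < 3 − 2Δ` and only for axial pairs, at a non-coincident quadruple `x`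
whose screened pair `[x₃/δ], [x₂/δ]` is axial along `e₀`): fat spread cluster (`stub_fatSpreadCluster`, landed) × capacity × Griffiths (`defectG_anti`) ×
depletion bound (`stub_depletionBound`, landed) ⟹ `P² ≥ c'c`. [cite: AizenmanDuminilCopinAnnals2021, eq. (3.11) and App. A Lemma A.1] -/
theorem twoCurrentMeet_lower_of_capacityAt {s : ℝ} (hs₀ : 0 < s)
    (hcap : ∀ K lam nu : ℝ, 0 < K → 0 < lam → 0 < nu →
      ∃ c' : ℝ, 0 < c' ∧ c' ≤ 1 ∧ ∃ R₀ : ℝ, ∀ c e : Site 3, (∀ j : Fin 3, j ≠ 0 → e j = c j) →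
        R₀ ≤ ‖c - e‖ → ∀ᶠ L : ℕ in atTop, ∀ C : Finset (Site 3), c ∉ C → e ∉ C →
          IsSpreadDefect s K lam nu c e C → defectG L C c e ≤ (1 - c') * boxG L c e)
    {ρ : ℝ → ℝ} {S : CorrFamily 3} {Δ : ℝ}
    (hρ : ∀ δ ∈ Set.Ioc (0:ℝ) 1, 0 < ρ δ) (hlim : HasPointwiseScalingLimit (criticalCorr 3) ρ S)
    (hnd : IsNondegenerateTwoPoint S) (hcov : ScaleCovariantOn Δ S) (hsΔ : s < 3 - 2 * Δ)
    {x : Fin 4 → EuclideanSpace ℝ (Fin 3)} (hx : x ∈ NonCoincident 3 4)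
    (hax : ∀ (δ : ℝ) (j : Fin 3), j ≠ 0 → lat δ x 3 j = lat δ x 2 j) :
    ∃ κ : ℝ, 0 < κ ∧ ∀ᶠ δ in 𝓝[>] (0:ℝ), ∀ᶠ L : ℕ in atTop,
      κ ≤ twoCurrentMeet L (lat δ x 0) (lat δ x 1) (lat δ x 2) (lat δ x 3) := by
  -- the spread sub-defect of the double cluster, with probability `≥ c`
  obtain ⟨K, lam, nu, hK, hlam, hnu, c, hc, hfat⟩ :=
    stub_fatSpreadCluster ρ S Δ hρ hlim hnd hcov s hs₀ hsΔ x hx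
  -- spread defects between axial pairs deplete, uniformly
  obtain ⟨c', hc', hc'1, R₀, hcapR⟩ := hcap K lam nu hK hlam hnu
  refine ⟨c' * c, mul_pos hc' hc, ?_⟩
  -- the pair `(x̃₂, x̃₃)` is axial and eventually `R₀`-separated
  have hinj : Function.Injective x := hx
  have h23 : x 2 ≠ x 3 := fun h => absurd (hinj h) (by decide)
  have hsep : ∀ᶠ δ in 𝓝[>] (0:ℝ), R₀ ≤ ‖lat δ x 2 - lat δ x 3‖ :=
    (tendsto_norm_latticeApprox_sub_atTop h23).eventually (eventually_ge_atTop R₀)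
  filter_upwards [hfat, hsep] with δ hfatδ hsepδ
  have hcapδ := hcapR (lat δ x 2) (lat δ x 3) (hax δ) hsepδ
  filter_upwards [hfatδ, hcapδ, eventually_lat_mem_box δ x ∅] with L hL hcapL hbox
  -- depletion of every cluster containing a spread defect: capacity + Griffiths monotonicity
  have hgood : ∀ C₀ : Finset (Site 3),
      (∃ C ⊆ C₀, lat δ x 2 ∉ C ∧ lat δ x 3 ∉ C ∧
        IsSpreadDefect s K lam nu (lat δ x 2) (lat δ x 3) C) →
      lat δ x 2 ∉ C₀ → lat δ x 3 ∉ C₀ → C₀ ⊆ box 3 (L + 1) →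
      defectG L C₀ (lat δ x 2) (lat δ x 3) ≤
        (1 - c') * boxG L (lat δ x 2) (lat δ x 3) := by
    rintro C₀ ⟨C, hCC₀, h2, h3, hspread⟩ h2₀ h3₀ -
    calc defectG L C₀ (lat δ x 2) (lat δ x 3)
        ≤ defectG L C (lat δ x 2) (lat δ x 3) :=
          defectG_anti hCC₀ (hbox.1 2) (hbox.1 3) h2₀ h3₀
      _ ≤ (1 - c') * boxG L (lat δ x 2) (lat δ x 3) := hcapL C h2 h3 hspread
  -- the depletion bound with the class `good C₀ := C₀ ⊇ some spread defect avoiding x̃₂, x̃₃`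
  have hdep := stub_depletionBound L (lat δ x 0) (lat δ x 1) (lat δ x 2)
    (lat δ x 3) (hbox.1 0) (hbox.1 1) (hbox.1 2) (hbox.1 3)
    (fun C₀ => ∃ C ⊆ C₀, lat δ x 2 ∉ C ∧ lat δ x 3 ∉ C ∧
      IsSpreadDefect s K lam nu (lat δ x 2) (lat δ x 3) C)
    c' hc'.le hc'1 hgood
  calc c' * c ≤ c' * (sourcedDoubleCurrentLaw 3 L (criticalBeta 3)
        ({lat δ x 0} ∆ {lat δ x 1}) ∅).real
        {ω | ∃ C ⊆ traceCluster L ω (lat δ x 0), lat δ x 2 ∉ C ∧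
          lat δ x 3 ∉ C ∧
          IsSpreadDefect s K lam nu (lat δ x 2) (lat δ x 3) C} :=
        mul_le_mul_of_nonneg_left hL hc'.le
    _ ≤ _ := hdep

/-- **Registered stub `stub_cruxOfIsingCapacityAxial` — THE CRUX FROM THE AXIAL ISING CAPACITY (the line's
sorry-free conditional assembly; conclusion = the route decl `PerfectScreening.CoulombImpliesNontrivial` BY NAME).**
If for ONE exponent `s ∈ (0,2)` spread `s`-dimensional free defects between axial pairs deplete the critical free-box
two-point function by a uniform fraction, then the Coulomb lower bound `c/‖x‖ ≤ ⟨σ₀σ_x⟩_{β_c}` forces `U₄ ≢ 0` for every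
non-degenerate pointwise scaling limit: under the antecedent the limit is scale covariant with `Δ = 1/2`
(`canonical_of_coulomb`, landed by the crux's disprover), so `s < 2 = 3 − 2Δ` feeds the engine
`twoCurrentMeet_lower_of_capacityAt` at the collinear axial quadruple `(0, e₀, 2e₀, 3e₀)`, and Aizenman's criterion
(`hasNontrivialU4_of_twoCurrentMeet_lower`, landed under crux 0636) concludes. CONDITIONAL theorem: it credits
nothing by itself; it records kernel-checked that crux 13885 is reduced to (a weakening of) crux 13886's open heart.
[cite: Aizenman1982, §1] -/
theorem stub_cruxOfIsingCapacityAxial :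
    (∃ s : ℝ, 0 < s ∧ s < 2 ∧ ∀ K lam nu : ℝ, 0 < K → 0 < lam → 0 < nu →
      ∃ c' : ℝ, 0 < c' ∧ c' ≤ 1 ∧ ∃ R₀ : ℝ, ∀ c e : Site 3, (∀ j : Fin 3, j ≠ 0 → e j = c j) →
        R₀ ≤ ‖c - e‖ → ∀ᶠ L : ℕ in atTop, ∀ C : Finset (Site 3), c ∉ C → e ∉ C →
          IsSpreadDefect s K lam nu c e C → defectG L C c e ≤ (1 - c') * boxG L c e) →
    Summit.CriticalPhenomena.Ising3DConformalLimit.Theses.PerfectScreening.CoulombImpliesNontrivial := by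
  intro hcap hC ρ S hρ hlim hnd
  obtain ⟨s, hs₀, hs₂, hcap⟩ := hcap
  have hcov : ScaleCovariantOn (1 / 2) S := (canonical_of_coulomb hC hρ hlim hnd).1
  -- the collinear axial reference quadruple `0, e₀, 2e₀, 3e₀`
  have hx : (fun i : Fin 4 => ((i : ℕ) : ℝ) • EuclideanSpace.single (0 : Fin 3) (1:ℝ)) ∈
      NonCoincident 3 4 := by
    intro i j hij
    have he : (EuclideanSpace.single (0 : Fin 3) (1:ℝ)) ≠ 0 := by
      intro h
      have := congrArg (fun v : EuclideanSpace ℝ (Fin 3) => v 0) h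
      simp at this
    have h := smul_left_injective ℝ he hij
    have h' : (i : ℕ) = (j : ℕ) := by exact_mod_cast h
    exact Fin.ext h'
  -- its screened pair `[2e₀/δ], [3e₀/δ]` is axial (both vanish off the first axis)
  have hax : ∀ (δ : ℝ) (j : Fin 3), j ≠ 0 →
      lat δ (fun i : Fin 4 => ((i : ℕ) : ℝ) • EuclideanSpace.single (0 : Fin 3) (1:ℝ)) 3 j =
        lat δ (fun i : Fin 4 => ((i : ℕ) : ℝ) • EuclideanSpace.single (0 : Fin 3) (1:ℝ)) 2 j := by
    intro δ j hj
    fin_cases j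
    · exact absurd rfl hj
    · simp [lat, latticeApprox_apply]
    · simp [lat, latticeApprox_apply]
  obtain ⟨κ, hκ, hev⟩ :=
    twoCurrentMeet_lower_of_capacityAt hs₀ hcap hρ hlim hnd hcov (by linarith) hx hax
  exact hasNontrivialU4_of_twoCurrentMeet_lower hlim hnd hx hκ hev

/-- **Crux 13886's registered `stub_isingCapacity` (all `s > 3/2`, all pairs) ⟹ crux 13885** — so the day the
sister line `karamata-amplitude-blind-merging` lands its open heart, `CoulombImpliesNontrivial` closes by this
one-liner. [cite: AizenmanDuminilCopinAnnals2021, App. A Lemma A.1 and Remark A.5] -/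
theorem coulombImpliesNontrivial_of_isingCapacity
    (hcap : ∀ s : ℝ, 3 / 2 < s → ∀ K lam nu : ℝ, 0 < K → 0 < lam → 0 < nu →
      ∃ c' : ℝ, 0 < c' ∧ c' ≤ 1 ∧ ∃ R₀ : ℝ, ∀ c e : Site 3, R₀ ≤ ‖c - e‖ →
        ∀ᶠ L : ℕ in atTop, ∀ C : Finset (Site 3), c ∉ C → e ∉ C →
          IsSpreadDefect s K lam nu c e C → defectG L C c e ≤ (1 - c') * boxG L c e) :
    Summit.CriticalPhenomena.Ising3DConformalLimit.Theses.PerfectScreening.CoulombImpliesNontrivial :=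
  stub_cruxOfIsingCapacityAxial (isingCapacityAxial_of_isingCapacity hcap)

end Summit.CriticalPhenomena.Ising3DConformalLimit.Cruxes.CoulombImpliesNontrivial.MergingIsExpectedScreening

end
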